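import Mathlib
import Literature.Combinatorics.Optimization.CorPolytopeApproximateEFLowerBound
import Literature.Barriers.PneNP.TSPExtensionComplexity
import HarnessLib

/-!
# The BFPS SANDWICH STUB of line `virtual_passenger` from the Literature fact (crux `NNDivisionHard`, stmt-ValiantsHypothesis-21181)

Theorems-side bridge (`--supports stmt-ValiantsHypothesis-21181`, helper; director-valiant g16 R294 (3) «BFPS Thm 6 = third KNOWN
port: Literature named fact for the type first, proof port second», desk val-lit g14 RULING #342 (C); hand val-port-3 g3) from the
named fact `Literature.Combinatorics.Optimization.BFPS2012_corSandwichHard` (Braun–Fiorini–Pokutta–Steurer 2012, Thm 6, second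
clause: `COR(n) ⊆ K ⊆ ρ·Q(n)`, `ρ = O(n^β)`, `β < 1/2` ⇒ `xc ≥ 2^{Ω(n^{1−2β})}`; file
`Literature/Combinatorics/Optimization/CorPolytopeApproximateEFLowerBound.lean`) to the statement of the KNOWN stub
`stub_corSandwichHard : CorSandwichHard` of the line of record `Cruxes/NNDivisionHard/Lines/virtual_passenger.lean` (pen val-idea-42 g0),
written δ-UNFOLDED (the line's `XcDivision.udRow a = flat (udMat a)`, `udMat a i j = 2·[i = j]·𝟙_a i − 𝟙_a i·𝟙_a j`,
`udInd a = bvec (· ∈ a)`, threshold `T c n = 2^((log₂ n + c)^c)` spelled out), so that the line closes its stub by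
`exact corSandwichHard_of_bfps h` (self-test against the tree's line file: by-name `example`, farm rc 0, recorded on the bus).

MECHANISM.  The line's CLASS-S hypothesis «every clique row `⟨2·diag(𝟙_a) − 𝟙_a 𝟙_aᵀ, x⟩ ≤ 1 + ⌊⌊√n⌋^{1/2}⌋` on `K`» says
`K ⊆ corOuter n ρ` with `ρ = 1 + ⌊⌊√n⌋^{1/2}⌋ ≤ 2·n^{1/4}` (`subset_corOuter_of_rows`, `rho_le`), so the fact at `β = 1/4`, `C = 2`
gives `2^{c·√n} ≤ r`; and the route threshold `2^((log₂ n + c₀)^{c₀})` is eventually below `2^{n^{1/4}} ≤ 2^{c√n}`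
(`polylog_lt_rpow_eventually`, adapted from val-idea-43 g3's lemma of the same name in `Lines/virtual_passenger_kmr.lean`).

HONEST LABEL: a vocabulary/threshold bridge for a KNOWN print theorem taken as a NAMED FACT (hypothesis `hB`); it proves nothing
about BFPS Thm 6 itself (proof port = Razborov's lemma + Yannakakis-for-pairs, L/XL, not here); 21181 `NNDivisionHard` OPEN, its
research stub `stub_coreLaw` untouched; nothing here is a summit statement; VP ≠ VNP is NOT proved.
-/

noncomputable section

-- single-conjunct layout: Sub = Summit, duplicated namespace component intended
set_option linter.dupNamespace false

namespace Summit.ValiantsHypothesis.ValiantsHypothesis.Theorems.FifoMatching.CorSandwich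

open Matrix Finset Filter Topology
open Literature.Combinatorics.Optimization (corCliqueMat corOuter BFPS2012_corSandwichHard)
open Literature.Combinatorics.Optimization.FixedSizePsdRank (Cube bvec vecOuter flat corPolytope)
open Literature.Barriers.PneNP (HasEFOfSize)

/-- The one analytic input: a fixed power of `log₂ n + c₀` is eventually below any positive real power of `n`.
(Adapted from val-idea-43 g3's `MaxCutLP.polylog_lt_rpow_eventually`, `Cruxes/NNDivisionHard/Lines/virtual_passenger_kmr.lean`.) -/
theorem polylog_lt_rpow_eventually (c₀ : ℕ) {c : ℝ} (hc : 0 < c) :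
    ∃ h₀ : ℕ, ∀ h ≥ h₀, (((Nat.log 2 h + c₀) ^ c₀ : ℕ) : ℝ) < (h : ℝ) ^ c := by
  set r : ℝ := (2 : ℝ) ^ c with hr_def
  have hr : 1 < r := Real.one_lt_rpow one_lt_two hc
  have h1 : Tendsto (fun k : ℕ => (((k + c₀ : ℕ) : ℝ)) ^ c₀ / r ^ (k + c₀)) atTop (𝓝 0) :=
    (tendsto_pow_const_div_const_pow_of_one_lt c₀ hr).comp (tendsto_add_atTop_nat c₀)
  have hε : (0 : ℝ) < 1 / r ^ c₀ := by positivity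
  obtain ⟨K, hK⟩ := Filter.eventually_atTop.mp (h1.eventually (gt_mem_nhds hε))
  refine ⟨2 ^ K, fun h hh => ?_⟩
  set k := Nat.log 2 h with hk
  have hh0 : h ≠ 0 := by
    have : 0 < 2 ^ K := Nat.two_pow_pos K
    omega
  have hlow : 2 ^ k ≤ h := Nat.pow_log_le_self 2 hh0
  have hKk : K ≤ k := by
    by_contra hlt
    push Not at hlt
    have : 2 ^ (k + 1) ≤ 2 ^ K := Nat.pow_le_pow_right (by norm_num) hlt
    have hup : h < 2 ^ (k + 1) := Nat.lt_pow_succ_log_self (by norm_num) h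
    omega
  have hA : (((k + c₀ : ℕ) : ℝ)) ^ c₀ / r ^ (k + c₀) < 1 / r ^ c₀ := hK k hKk
  have hpos : (0 : ℝ) < r ^ (k + c₀) := by positivity
  have hA' : (((k + c₀ : ℕ) : ℝ)) ^ c₀ < 1 / r ^ c₀ * r ^ (k + c₀) := (div_lt_iff₀ hpos).mp hA
  have hsplit : 1 / r ^ c₀ * r ^ (k + c₀) = r ^ k := by
    rw [pow_add]; field_simp
  rw [hsplit] at hA'
  have hrk : r ^ k = ((2 : ℝ) ^ k) ^ c := by
    rw [hr_def, ← Real.rpow_mul_natCast (by norm_num : (0 : ℝ) ≤ 2), mul_comm,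
      Real.rpow_natCast_mul (by norm_num : (0 : ℝ) ≤ 2)]
  have hle : ((2 : ℝ) ^ k) ^ c ≤ (h : ℝ) ^ c :=
    Real.rpow_le_rpow (by positivity) (by exact_mod_cast hlow) hc.le
  have hcast : (((Nat.log 2 h + c₀) ^ c₀ : ℕ) : ℝ) = (((k + c₀ : ℕ) : ℝ)) ^ c₀ := by
    rw [hk]; push_cast; ring
  rw [hcast]
  calc (((k + c₀ : ℕ) : ℝ)) ^ c₀ < r ^ k := hA'
    _ = ((2 : ℝ) ^ k) ^ c := hrk
    _ ≤ (h : ℝ) ^ c := hle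

/-- The route threshold `2^((log₂ n + c₀)^{c₀})` is below `r` as soon as `2^{n^{c₃}} ≤ r`, eventually in `n` (any `c₃ > 0`). -/
theorem threshold_lt_of_rpow_bound (c₀ : ℕ) {c₃ : ℝ} (hc₃ : 0 < c₃) :
    ∃ h₀ : ℕ, ∀ n ≥ h₀, ∀ r : ℕ, (2 : ℝ) ^ ((n : ℝ) ^ c₃) ≤ r → 2 ^ ((Nat.log 2 n + c₀) ^ c₀) < r := by
  obtain ⟨h₀, hh₀⟩ := polylog_lt_rpow_eventually c₀ hc₃
  refine ⟨h₀, fun n hn r hr => ?_⟩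
  have hlt : (((Nat.log 2 n + c₀) ^ c₀ : ℕ) : ℝ) < (n : ℝ) ^ c₃ := hh₀ n hn
  have hT : (((2 ^ ((Nat.log 2 n + c₀) ^ c₀) : ℕ) : ℕ) : ℝ) = (2 : ℝ) ^ ((((Nat.log 2 n + c₀) ^ c₀ : ℕ) : ℝ)) := by
    rw [Real.rpow_natCast]; push_cast; rfl
  have h2 : (2 : ℝ) ^ ((((Nat.log 2 n + c₀) ^ c₀ : ℕ) : ℝ)) < (2 : ℝ) ^ ((n : ℝ) ^ c₃) :=
    Real.rpow_lt_rpow_of_exponent_lt (by norm_num) hlt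
  have : (((2 ^ ((Nat.log 2 n + c₀) ^ c₀) : ℕ) : ℕ) : ℝ) < r := by rw [hT]; exact lt_of_lt_of_le h2 hr
  exact_mod_cast this

/-- The line's clique row matrix of a subset `a ⊆ [n]` (`XcDivision.udMat a`, spelled out) IS the Literature clique matrix
`2·diag(𝟙_a) − 𝟙_a 𝟙_aᵀ` of its indicator. -/
theorem udMat_eq_corCliqueMat {n : ℕ} (a : Finset (Fin n)) :
    (fun i j : Fin n => 2 * (if i = j then 1 else 0) * bvec (fun i => decide (i ∈ a)) i -
        bvec (fun i => decide (i ∈ a)) i * bvec (fun i => decide (i ∈ a)) j) =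
      corCliqueMat (fun i => decide (i ∈ a)) := by
  ext i j
  simp only [corCliqueMat, Matrix.sub_apply, Matrix.smul_apply, Matrix.diagonal_apply, Matrix.vecMulVec_apply, smul_eq_mul]
  by_cases hij : i = j
  · subst hij; simp
  · simp [hij]

/-- Every 0/1 vector is the indicator of its support: the Finset-indexed clique rows of the line exhaust BFPS's `a ∈ {0,1}ⁿ`. -/
theorem corCliqueMat_eq_of_cube {n : ℕ} (a : Cube n) :
    corCliqueMat a = corCliqueMat (fun i => decide (i ∈ Finset.univ.filter fun i => a i = true)) := by
  have : (fun i => decide (i ∈ Finset.univ.filter fun i => a i = true)) = a := by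
    funext i; simp
  rw [this]

/-- The line's row hypothesis «every clique row is `≤ 1 + ⌊⌊√n⌋^{1/2}⌋` on `K`» places `K` inside BFPS's dilated outer polyhedron
`corOuter n (1 + ⌊⌊√n⌋^{1/2}⌋)`. -/
theorem subset_corOuter_of_rows {n : ℕ} (K : Set (Fin (n * n) → ℝ))
    (hrows : ∀ x ∈ K, ∀ a : Finset (Fin n),
      flat (fun i j : Fin n => 2 * (if i = j then 1 else 0) * bvec (fun i => decide (i ∈ a)) i -
          bvec (fun i => decide (i ∈ a)) i * bvec (fun i => decide (i ∈ a)) j) ⬝ᵥ x ≤ 1 + Nat.sqrt (Nat.sqrt n)) :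
    K ⊆ corOuter n (1 + Nat.sqrt (Nat.sqrt n)) := by
  intro x hx a
  have h := hrows x hx (Finset.univ.filter fun i => a i = true)
  rw [udMat_eq_corCliqueMat, ← corCliqueMat_eq_of_cube] at h
  exact h

/-- `⌊⌊√n⌋^{1/2}⌋ ≤ n^{1/4}` (real fourth root). -/
theorem natSqrt_natSqrt_le_rpow (n : ℕ) : ((Nat.sqrt (Nat.sqrt n) : ℕ) : ℝ) ≤ (n : ℝ) ^ (1 / 4 : ℝ) := by
  set s := Nat.sqrt (Nat.sqrt n) with hs
  have h4 : s ^ 4 ≤ n := by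
    have h1 : s ^ 2 ≤ Nat.sqrt n := Nat.sqrt_le' (Nat.sqrt n)
    have h2 : Nat.sqrt n ^ 2 ≤ n := Nat.sqrt_le' n
    calc s ^ 4 = (s ^ 2) ^ 2 := by ring
      _ ≤ (Nat.sqrt n) ^ 2 := Nat.pow_le_pow_left h1 2
      _ ≤ n := h2
  have h4r : ((s : ℝ)) ^ (4 : ℕ) ≤ (n : ℝ) := by exact_mod_cast h4
  have hs0 : (0 : ℝ) ≤ s := by positivity
  calc (s : ℝ) = (((s : ℝ)) ^ (4 : ℕ)) ^ ((4 : ℕ)⁻¹ : ℝ) := (Real.pow_rpow_inv_natCast hs0 (by norm_num)).symm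
    _ = (((s : ℝ)) ^ (4 : ℕ)) ^ (1 / 4 : ℝ) := by norm_num
    _ ≤ (n : ℝ) ^ (1 / 4 : ℝ) := Real.rpow_le_rpow (by positivity) h4r (by norm_num)

/-- The line's ratio `ρ(n) = 1 + ⌊⌊√n⌋^{1/2}⌋` is `O(n^{1/4})` with constant `2`, for `n ≥ 1`. -/
theorem rho_le {n : ℕ} (hn : 1 ≤ n) : (1 : ℝ) + (Nat.sqrt (Nat.sqrt n) : ℕ) ≤ 2 * (n : ℝ) ^ (1 / 4 : ℝ) := by
  have h1 : (1 : ℝ) ≤ (n : ℝ) ^ (1 / 4 : ℝ) := Real.one_le_rpow (by exact_mod_cast hn) (by norm_num)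
  have h2 := natSqrt_natSqrt_le_rpow n
  linarith

/-- ★ **THE BRIDGE — `stub_corSandwichHard` of line `virtual_passenger` from BFPS 2012 Thm 6** (statement of the line's
`VirtualPassenger.CorSandwichHard` δ-unfolded; the line closes its KNOWN stub by `exact corSandwichHard_of_bfps hB`): for every `c`,
eventually in `n`, every `K ⊆ ℝ^{n²}` containing `COR(n)` on which every clique row `⟨2·diag(𝟙_a) − 𝟙_a𝟙_aᵀ, ·⟩` is
`≤ 1 + ⌊⌊√n⌋^{1/2}⌋` and which has a slack-form extended formulation with `r` inequalities has `2^((log₂ n + c)^c) < r`.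
CONDITIONAL on the named fact `BFPS2012_corSandwichHard` (hypothesis `hB`). -/
theorem corSandwichHard_of_bfps (hB : BFPS2012_corSandwichHard) :
    ∀ c : ℕ, ∃ n₀ : ℕ, ∀ n ≥ n₀, ∀ (K : Set (Fin (n * n) → ℝ)) (r : ℕ),
      Literature.Combinatorics.Optimization.FixedSizePsdRank.corPolytope n ⊆ K →
      (∀ x ∈ K, ∀ a : Finset (Fin n),
        flat (fun i j : Fin n => 2 * (if i = j then 1 else 0) * bvec (fun i => decide (i ∈ a)) i -
            bvec (fun i => decide (i ∈ a)) i * bvec (fun i => decide (i ∈ a)) j) ⬝ᵥ x ≤ 1 + Nat.sqrt (Nat.sqrt n)) →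
      HasEFOfSize K r → 2 ^ ((Nat.log 2 n + c) ^ c) < r := by
  intro c₀
  obtain ⟨c, hc, n₁, hn₁⟩ := hB (1 / 4) (by norm_num) (by norm_num) 2 (by norm_num)
  obtain ⟨h₀, hh₀⟩ := threshold_lt_of_rpow_bound c₀ (c₃ := 1 / 4) (by norm_num)
  -- `N`: from here on `c · n^{1/4} ≥ 1`
  set N : ℕ := ⌈(1 / c) ^ (4 : ℕ)⌉₊ with hN
  refine ⟨max (max n₁ h₀) (max N 1), fun n hn K r hP hrows hEF => ?_⟩
  have hn₁' : n₁ ≤ n := le_trans (le_trans (le_max_left _ _) (le_max_left _ _)) hn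
  have hh₀' : h₀ ≤ n := le_trans (le_trans (le_max_right _ _) (le_max_left _ _)) hn
  have hN' : N ≤ n := le_trans (le_trans (le_max_left _ _) (le_max_right _ _)) hn
  have hn1 : 1 ≤ n := le_trans (le_trans (le_max_right _ _) (le_max_right _ _)) hn
  -- the sandwich at ratio `ρ = 1 + ⌊⌊√n⌋^{1/2}⌋ ≤ 2 n^{1/4}`
  have hQ := subset_corOuter_of_rows K hrows
  have hρ1 : (1 : ℝ) ≤ 1 + (Nat.sqrt (Nat.sqrt n) : ℕ) := by
    have : (0 : ℝ) ≤ (Nat.sqrt (Nat.sqrt n) : ℕ) := by positivity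
    linarith
  have hfact := hn₁ n hn₁' _ hρ1 (rho_le hn1) K r hP hQ hEF
  norm_num at hfact
  -- `hfact : 2 ^ (c * n ^ (1/2)) ≤ r`; compare with `2 ^ (n ^ (1/4))`
  have hnpos : (0 : ℝ) < n := by exact_mod_cast hn1
  have hq0 : (0 : ℝ) ≤ (n : ℝ) ^ (1 / 4 : ℝ) := by positivity
  have hcq : (1 : ℝ) ≤ c * (n : ℝ) ^ (1 / 4 : ℝ) := by
    have hNle : (1 / c) ^ (4 : ℕ) ≤ (n : ℝ) := le_trans (Nat.le_ceil _) (by exact_mod_cast hN')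
    have hroot : ((1 / c) ^ (4 : ℕ)) ^ ((4 : ℕ)⁻¹ : ℝ) ≤ (n : ℝ) ^ ((4 : ℕ)⁻¹ : ℝ) :=
      Real.rpow_le_rpow (by positivity) hNle (by norm_num)
    rw [Real.pow_rpow_inv_natCast (by positivity) (by norm_num)] at hroot
    have h4 : ((4 : ℕ)⁻¹ : ℝ) = 1 / 4 := by norm_num
    rw [h4] at hroot
    have := mul_le_mul_of_nonneg_left hroot hc.le
    rwa [mul_one_div_cancel hc.ne'] at this
  have hexp : (n : ℝ) ^ (1 / 4 : ℝ) ≤ c * (n : ℝ) ^ (1 / 2 : ℝ) := by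
    have hsplit : (n : ℝ) ^ (1 / 2 : ℝ) = (n : ℝ) ^ (1 / 4 : ℝ) * (n : ℝ) ^ (1 / 4 : ℝ) := by
      rw [← Real.rpow_add hnpos]; norm_num
    calc (n : ℝ) ^ (1 / 4 : ℝ) = (n : ℝ) ^ (1 / 4 : ℝ) * 1 := (mul_one _).symm
      _ ≤ (n : ℝ) ^ (1 / 4 : ℝ) * (c * (n : ℝ) ^ (1 / 4 : ℝ)) := mul_le_mul_of_nonneg_left hcq hq0
      _ = c * (n : ℝ) ^ (1 / 2 : ℝ) := by rw [hsplit]; ring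
  have hpow : (2 : ℝ) ^ ((n : ℝ) ^ (1 / 4 : ℝ)) ≤ (2 : ℝ) ^ (c * (n : ℝ) ^ (1 / 2 : ℝ)) :=
    Real.rpow_le_rpow_of_exponent_le (by norm_num) hexp
  exact hh₀ n hh₀' r (le_trans hpow hfact)

end Summit.ValiantsHypothesis.ValiantsHypothesis.Theorems.FifoMatching.CorSandwich
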